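/- Copyright: the b2b-balaban cell (near-miss cell 7), T⁴-continuum fan-out, lineage t4-ne7b-p1 (node U5c COUNT
member).  Released under the licence of the surrounding project. -/
import Summits.QuantumFields.BalabanUV.T4Continuum.Support.HistoryGenealogyJunctionVClauses
import Summits.QuantumFields.BalabanUV.T4Continuum.Support.HistoryGenealogyJunctionFamily
import Summits.QuantumFields.BalabanUV.T4Continuum.Support.HistoryGenealogyInstantiateMSanity
import Summits.QuantumFields.BalabanUV.T4Continuum.Support.HistoryGenealogyDissolveEvProd
import Summits.QuantumFields.BalabanUV.T4Continuum.Support.HistoryGenealogyPedigreeEvProd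

/-!
# THE JUNCTION, PASS V (part 3b — the seven fields WITHOUT «no fresh clusters»): print's level-by-level construction
of the large-field components (`RunInputM`), with its fresh clusters dissolved by the virtual-step encoding, READ IN
THE END's CURRENCY: the pedigree `pedMV` satisfies `renew_step` ∕ `forest` ∕ **`headOldest`** ∕ `real` ∕ `track` ∕
`disjoint` ∕ `inBox` of the memory-agnostic carriers at every cutoff, and a term-indexed family of such inputs forms
`RealisedDomainsRW` — the located open point G-M4-1 is CLOSED AT THE JUNCTION (owner module of row NE7b, lineage
`t4-ne7b-p1` gen 42; ruling R-OWNER-42-1 «pass V supersedes pass T» = R-OWNER-22-7 (α) at the junction; re-open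
object (α), `SCOPE-alpha.md` v2.3 §5 row M4 — PRE-POSITIONING ONLY)

Summits-side support leaf of the T⁴-continuum cell (rung (B)+1 on a FINITE torus only; NOT infinite volume, NOT the
mass gap, NOT the Clay statement; NOT a proof of the spine estimate NE7b, which is the cell's OWN estimate, NOT PRINTED
and NOT PROVED).  [folklore] finite combinatorics in the ℤᵈ index model over parts 1a–3a of pass V, bricks 2a–3b
(`pedOf`, `ordOf`, `forest_pedOf_ordOf`, `headOldest_pedOf_ordOf`, `realisesW_toPGen_ordOf`, `lastStep_toPGen_ordOf`,
`anchorAt_toPGen_mem_edomR`, `rootCell_toPGen_mem_newReg`), the junction of record (`HistoryGenealogyJunction` p251528: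
`InBoxOK`, the seven field shapes under `NoFreshClusters`) and its packaging (`HistoryGenealogyJunctionFamily`
p251762: `InputFamily`, `RealisedDomainsRW`); nothing printed is asserted, no `def … : Prop` fact of Bałaban's, no
cite-tagged hypothesis, zero `sorry`.  B15 p. 177 ∕ B16 pp. 383–387 under audit; locators only.

WHY ∕ WHAT.  The junction of record displays `NoFreshClusters histM` — false for print's process whenever several new
regions touch with no old line (B16 p. 385).  Pass V (parts 1a–3a) dissolves those clusters in the bookkeeping:
`histV`, with `WF`, cover, `NoFreshClusters` and `LevelClausesW` PROVED under input-side conditions.  THIS FILE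
instantiates the bricks on `histV`: `pedMV := pedOf histV rnwM (ordOf …)`, `liveCV K := histV.comp K` (real
non-fresh components, and at a fresh cluster's own level its regions separately), `ZMV K c := edomR histV … K c`, and
proves `renew_step_pedMV`, `forest_pedMV`, **`headOldest_pedMV` (NO «no fresh clusters» hypothesis)**,
**`real_pedMV`** (`RealisesW ∧ PendingBefore … K`: realisation by the bricks; pendency at the cutoff from `invM`
through the DICHOTOMY — verbatim for unchanged lines, by the MEMORY SHIFT for V-lines, trivially for pseudo-births),
`track_pedMV`, **`disjoint_pedMV`** (real∕real: disjoint live domains; real∕pseudo: the region lies in its cluster, a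
different live line; pseudo∕pseudo: `NewDisjoint`), `inBox_pedMV`; **`junction_pedMV`**; and the family form
**`InputFamily.realisedDomainsRW_of_familyV`** whose displayed per-term conditions are `NewOK`, `Rm ≤ R`,
`Rm t (k+1) ≤ R (t+1)`, `2 ≤ Rm t 1`, `NewDisjoint`, `0 < L`, `InBoxOK` — all INPUT-side, no located open point.

HONEST.  Proves nothing of Bałaban's; the identification of the inputs with (2.18)[III]∕(1.72)[V] is M2's residual
reading; the memory side conditions are met by print's current-memory reading for non-increasing `R ≥ 2` and NOT by
the frozen model in general; by-name class of every `WALL-NE7b-P1.md` §2 binder UNCHANGED; NE7b NOT proved; spine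
0∕9.  HONEST DEPENDENCY (cell): continuum YM on T⁴ ⇐ BetaPertH ∧ nine spine estimates (0/9 proved); BetaPertH ⇐ (D1)
∧ (D4) ∧ CAP+tail; G-an2-4 gates asym, D1 and NE2/3/4.  This file changes none of it. -/

open Finset
open Literature.MathematicalPhysics.QuantumFieldTheory.Balaban1983to89
open Literature.MathematicalPhysics.QuantumFieldTheory.Balaban1983to89.B13ScaleTransfer
open Literature.MathematicalPhysics.QuantumFieldTheory.Balaban1983to89.B16SProfile
open Literature.MathematicalPhysics.QuantumFieldTheory.Balaban1983to89.B16MergeGeometry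
open T4PersistenceDictionary
open Summit.QuantumFields.BalabanUV.T4Continuum.HistoryAdmissible
open Summit.QuantumFields.BalabanUV.T4Continuum.HistoryRealise
open Summit.QuantumFields.BalabanUV.T4Continuum.HistoryRealisePrint
open Summit.QuantumFields.BalabanUV.T4Continuum.HistoryRealiseWeak
open Summit.QuantumFields.BalabanUV.T4Continuum.HistoryRealiseMemory
open Summit.QuantumFields.BalabanUV.T4Continuum.HistoryRealiseCells
open Summit.QuantumFields.BalabanUV.T4Continuum.HistoryRealiseWeakCells
open Summit.QuantumFields.BalabanUV.T4Continuum.HistoryZones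
open Summit.QuantumFields.BalabanUV.T4Continuum.HistoryGen
open Summit.QuantumFields.BalabanUV.T4Continuum.HistoryGenealogyExtraction
open Summit.QuantumFields.BalabanUV.T4Continuum.HistoryGenealogyRealise
open Summit.QuantumFields.BalabanUV.T4Continuum.HistoryGenealogyRealise.GeomHistoryR
open Summit.QuantumFields.BalabanUV.T4Continuum.HistoryGenealogyPedigree
open Summit.QuantumFields.BalabanUV.T4Continuum.HistoryTouchComponents

namespace Summit.QuantumFields.BalabanUV.T4Continuum.HistoryGenealogyInstantiate

noncomputable section

open Classical

variable {d : ℕ}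

namespace RunInputM

variable (I : RunInputM d)

/-! ## §1 The pedigree of the dissolved process, its last-event domains, its live sets -/

/-- the chosen (oldest-first contact) order of the constituents of the dissolved components [folklore] -/
def ordMV : ℕ → Lab d → List (Lab d ⊕ Lab d) := ordOf I.histV I.rnwM RunInput.domL I.L I.s

/-- **THE PEDIGREE OF THE DISSOLVED PROCESS** in the END's currency (names `(level, label)`, payloads = new regions;
a fresh cluster enters its descendants as a join ONE LEVEL LATE of the births of its regions). [folklore] -/
def pedMV : Pedigree (ℕ × Lab d) (Lab d) := pedOf I.histV I.rnwM I.ordMV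

/-- the LAST-EVENT DOMAIN of the dissolved component labelled `c` at level `K` [folklore] -/
def ZMV (K : ℕ) (c : Lab d) : Finset (Pt d) := edomR I.histV I.rnwM RunInput.domL K c

variable {I}

/-! ## §2 The three encoding fields — `headOldest` with NO displayed condition -/

/-- **`renew_step`** for the dissolved process's pedigree (every name). [folklore] -/
theorem renew_step_pedMV (c c' : ℕ × Lab d) (h : Part.old c' true ∈ I.pedMV.parts c) : I.pedMV.step c' + 1 = I.pedMV.step c :=
  renew_step_pedOf I.histV I.rnwM I.ordMV c c' h

/-- **`forest`** for the dissolved process's pedigree (every name). [folklore] -/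
theorem forest_pedMV (hN : I.NewOK) (hRm : ∀ t k, I.Rm t k ≤ I.R t) (hRmS : ∀ t k, I.Rm t (k + 1) ≤ I.R (t + 1))
    (hRm2 : ∀ t, 2 ≤ I.Rm t 1) (hD : I.NewDisjoint) (hL : 0 < I.L) (c : ℕ × Lab d) : I.pedMV.Forest c :=
  forest_pedOf_ordOf (wf_histV hN hRm hD hL) (levelClausesW_histV hN hRm hRmS hRm2 hD hL) c

/-- **`headOldest`** for the dissolved process's pedigree (every name) — the located open point G-M4-1 DISCHARGED: no
«no fresh clusters» hypothesis. [folklore] -/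
theorem headOldest_pedMV (hN : I.NewOK) (hRm : ∀ t k, I.Rm t k ≤ I.R t) (hRmS : ∀ t k, I.Rm t (k + 1) ≤ I.R (t + 1))
    (hRm2 : ∀ t, 2 ≤ I.Rm t 1) (hD : I.NewDisjoint) (hL : 0 < I.L) (c : ℕ × Lab d) : I.pedMV.HeadOldest c :=
  headOldest_pedOf_ordOf (wf_histV hN hRm hD hL) (levelClausesW_histV hN hRm hRmS hRm2 hD hL)
    (noFreshClusters_histV hN hRm hD hL) c

/-! ## §3 `real`: realised, and pending strictly before the cutoff -/

/-- every live dissolved component is `RealisesW`-realised by its last-event domain [folklore] -/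
theorem realisesW_pedMV (hN : I.NewOK) (hRm : ∀ t k, I.Rm t k ≤ I.R t) (hRmS : ∀ t k, I.Rm t (k + 1) ≤ I.R (t + 1))
    (hRm2 : ∀ t, 2 ≤ I.Rm t 1) (hD : I.NewDisjoint) (hL : 0 < I.L) {K : ℕ} {c : Lab d} (hc : c ∈ I.histV.comp K) :
    RealisesW I.L I.s I.R (I.pedMV.toPGen id (K, c)) (I.ZMV K c) :=
  (realisesW_toPGen_ordOf (wf_histV hN hRm hD hL) (levelClausesW_histV hN hRm hRmS hRm2 hD hL) hc).1

/-- the current domain of a live dissolved component is the orbit of its last-event domain from its last step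
[folklore] -/
theorem domL_eq_curDomain_pedMV (hN : I.NewOK) (hRm : ∀ t k, I.Rm t k ≤ I.R t)
    (hRmS : ∀ t k, I.Rm t (k + 1) ≤ I.R (t + 1)) (hRm2 : ∀ t, 2 ≤ I.Rm t 1) (hD : I.NewDisjoint) (hL : 0 < I.L)
    {K : ℕ} {c : Lab d} (hc : c ∈ I.histV.comp K) : c.2 = curDomain I.L I.s (I.pedMV.toPGen id (K, c)) (I.ZMV K c) K :=
  (realisesW_toPGen_ordOf (wf_histV hN hRm hD hL) (levelClausesW_histV hN hRm hRmS hRm2 hD hL) hc).2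

/-- **every live dissolved component is pending STRICTLY BEFORE the cutoff** (frozen memory): a pseudo-component is
a birth of the cutoff level; a real line is `Rm`-unready since its last event (`invM`), which gives frozen pendency
from the SAME event by domination for an unchanged line, and from the LATER virtual event by the memory shift for a
V-line. [folklore] -/
theorem pendingBefore_pedMV (hN : I.NewOK) (hRm : ∀ t k, I.Rm t k ≤ I.R t) (hRmS : ∀ t k, I.Rm t (k + 1) ≤ I.R (t + 1))
    (hRm2 : ∀ t, 2 ≤ I.Rm t 1) (hD : I.NewDisjoint) (hL : 0 < I.L) {K : ℕ} {c : Lab d} (hc : c ∈ I.histV.comp K) :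
    PendingBefore I.L I.s I.R (I.pedMV.toPGen id (K, c)).lastStep (I.ZMV K c) K := by
  have hW := I.wf_histM hN
  have hLab := labelOK_histM hN hD
  have hSO := ComponentHistory.spliceOK_of_splGood (splGood_splV hN hRm hL)
  have hlast : (I.pedMV.toPGen id (K, c)).lastStep = (I.histV.pgenR I.rnwM K c).lastStep :=
    (lastStep_toPGen_ordOf (wf_histV hN hRm hD hL) (levelClausesW_histV hN hRm hRmS hRm2 hD hL) hc).1
  rw [hlast]
  rcases ComponentHistory.real_or_pseudo hLab hc with ⟨hcm, hf, -⟩ | ⟨hp, -⟩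
  · obtain ⟨τ, hτ, rfl⟩ : ∃ τ ∈ I.StM K, lab τ = c := by
      have : c ∈ (I.StM K).image lab := hcm
      simpa only [Finset.mem_image] using this
    obtain ⟨hle, ht, hE, hpend⟩ := I.invM hN K τ hτ
    rcases ComponentHistory.lastStep_edomR_dissolve (rnw := I.rnwM) (dom := RunInput.domL) (L := I.L) (s := I.s)
        hW hSO hLab (fresh_rnwM hN) (I.levelClausesW_histM hN hRm).dom_flow K (lab τ) hcm hf with ⟨h1, h2⟩ | ⟨h1, h1', h3⟩
    · rw [show (I.histV.pgenR I.rnwM K (lab τ)).lastStep = _ from h1, ← ht]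
      refine ⟨hle, fun k hk => ?_⟩
      rw [show I.ZMV K (lab τ) = _ from h2, ← hE]
      exact I.not_stops_of_not_stopsM hRm (hpend k hk)
    · rw [show (I.histV.pgenR I.rnwM K (lab τ)).lastStep = _ from h1, ← ht]
      refine ⟨by rw [ht]; exact h1', fun k hk => ?_⟩
      rw [show I.ZMV K (lab τ) = _ from h3, ← ht, ← hE]
      exact not_stops_succ_of_not_stopsM (hRmS τ.t k) (hpend (k + 1) (by omega))
  · rw [show (I.histV.pgenR I.rnwM K c) = _ from ComponentHistory.pgenR_dissolve_pseudo hp]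
    refine ⟨le_rfl, fun k hk => ?_⟩
    rw [show (PGen.birth K (I.histM.cls c) c).lastStep = K from rfl, Nat.sub_self] at hk
    exact absurd hk (Nat.not_lt_zero k)

/-- **`real`** for the dissolved process. [folklore] -/
theorem real_pedMV (hN : I.NewOK) (hRm : ∀ t k, I.Rm t k ≤ I.R t) (hRmS : ∀ t k, I.Rm t (k + 1) ≤ I.R (t + 1))
    (hRm2 : ∀ t, 2 ≤ I.Rm t 1) (hD : I.NewDisjoint) (hL : 0 < I.L) {K : ℕ} {c : Lab d} (hc : c ∈ I.histV.comp K) :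
    RealisesW I.L I.s I.R (I.pedMV.toPGen id (K, c)) (I.ZMV K c) ∧
      PendingBefore I.L I.s I.R (I.pedMV.toPGen id (K, c)).lastStep (I.ZMV K c) K :=
  ⟨realisesW_pedMV hN hRm hRmS hRm2 hD hL hc, pendingBefore_pedMV hN hRm hRmS hRm2 hD hL hc⟩

/-! ## §4 `track`, `disjoint`, `inBox` -/

/-- **`track`** for the dissolved process. [folklore] -/
theorem track_pedMV (hN : I.NewOK) (hRm : ∀ t k, I.Rm t k ≤ I.R t) (hRmS : ∀ t k, I.Rm t (k + 1) ≤ I.R (t + 1))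
    (hRm2 : ∀ t, 2 ≤ I.Rm t 1) (hD : I.NewDisjoint) (hL : 0 < I.L) {K : ℕ} {c : Lab d} (hc : c ∈ I.histV.comp K) :
    anchorAt I.L I.s (I.pedMV.toPGen id (K, c)) (I.pedMV.toPGen id (K, c)).lastStep ∈ I.ZMV K c :=
  anchorAt_toPGen_mem_edomR (wf_histV hN hRm hD hL) (levelClausesW_histV hN hRm hRmS hRm2 hD hL)
    (coverOK_histV hN hRm hD hL) K c hc

/-- **LIVE DOMAINS OF THE DISSOLVED BOOKKEEPING ARE PAIRWISE DISJOINT** at every level: two real lines (print's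
components are disjoint), a real line and a region of a fresh cluster (the region lies in its cluster, another
component), two regions (`NewDisjoint`). [folklore] -/
theorem disjoint_snd_of_mem_histV (hN : I.NewOK) (hD : I.NewDisjoint) {K : ℕ} {c c' : Lab d} (hc : c ∈ I.histV.comp K)
    (hc' : c' ∈ I.histV.comp K) (hne : c ≠ c') : Disjoint c.2 c'.2 := by
  have hW := I.wf_histM hN
  have hLab := labelOK_histM hN hD
  -- a real component is a live line; a pseudo-component's region lies inside its cluster's line and in `N K`
  have hreal : ∀ {x : Lab d}, x ∈ I.histM.comp K → ∃ τ ∈ I.StM K, lab τ = x := fun {x} hx => by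
    have : x ∈ (I.StM K).image lab := hx
    simpa only [Finset.mem_image] using this
  have hpseudo : ∀ {n : Lab d}, n ∈ I.histM.pseudo K →
      n ∈ I.N K ∧ ∃ c₀, I.histM.Fresh K c₀ ∧ n.2 ⊆ c₀.2 := fun {n} hn => by
    obtain ⟨c₀, hf₀, hn₀⟩ := I.histM.mem_pseudo_iff.1 hn
    obtain ⟨T, hT, hT₀⟩ := I.mem_compM_iff.1 hf₀.mem
    have hnT : Sum.inr n ∈ T := inr_mem_block_of_fresh_news hN hT (hT₀ ▸ hn₀)
    refine ⟨(I.inr_mem_vertM).1 (subset_of_mem_tcomps hT hnT), c₀, hf₀, ?_⟩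
    rw [← hT₀, lab_snd, newLineM_D]
    exact subset_fam (I.P K) hnT
  have hdisjM : ∀ {x y : Lab d}, x ∈ I.histM.comp K → y ∈ I.histM.comp K → x ≠ y → Disjoint x.2 y.2 :=
    fun {x y} hx hy hxy => by
      obtain ⟨τ, hτ, rfl⟩ := hreal hx
      obtain ⟨τ', hτ', rfl⟩ := hreal hy
      have : τ ≠ τ' := fun h => hxy (by rw [h])
      simpa only [lab_snd] using (I.StM_nonempty_disjoint hN K).2 τ hτ τ' hτ' this
  rcases ComponentHistory.real_or_pseudo hLab hc with ⟨hcm, hf, -⟩ | ⟨hp, -⟩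
  · rcases ComponentHistory.real_or_pseudo hLab hc' with ⟨hcm', -, -⟩ | ⟨hp', -⟩
    · exact hdisjM hcm hcm' hne
    · obtain ⟨-, c₀, hf₀, hsub⟩ := hpseudo hp'
      have hne₀ : c ≠ c₀ := fun h => hf (h ▸ hf₀)
      exact Finset.disjoint_of_subset_right hsub (hdisjM hcm hf₀.mem hne₀)
  · rcases ComponentHistory.real_or_pseudo hLab hc' with ⟨hcm', hf', -⟩ | ⟨hp', -⟩
    · obtain ⟨-, c₀, hf₀, hsub⟩ := hpseudo hp
      have hne₀ : c₀ ≠ c' := fun h => hf' (h ▸ hf₀)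
      exact Finset.disjoint_of_subset_left hsub (hdisjM hf₀.mem hcm' hne₀)
    · exact hD K c (hpseudo hp).1 c' (hpseudo hp').1 hne

/-- **`disjoint`** for the dissolved process: distinct live components have disjoint current domains at the cutoff.
[folklore] -/
theorem disjoint_pedMV (hN : I.NewOK) (hRm : ∀ t k, I.Rm t k ≤ I.R t) (hRmS : ∀ t k, I.Rm t (k + 1) ≤ I.R (t + 1))
    (hRm2 : ∀ t, 2 ≤ I.Rm t 1) (hD : I.NewDisjoint) (hL : 0 < I.L) {K : ℕ} {c c' : Lab d} (hc : c ∈ I.histV.comp K)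
    (hc' : c' ∈ I.histV.comp K) (hne : c ≠ c') :
    Disjoint (curDomain I.L I.s (I.pedMV.toPGen id (K, c)) (I.ZMV K c) K)
      (curDomain I.L I.s (I.pedMV.toPGen id (K, c')) (I.ZMV K c') K) := by
  rw [← domL_eq_curDomain_pedMV hN hRm hRmS hRm2 hD hL hc, ← domL_eq_curDomain_pedMV hN hRm hRmS hRm2 hD hL hc']
  exact disjoint_snd_of_mem_histV hN hD hc hc' hne

/-- the root cell of a live dissolved component is a new region of the input, born at the root step `≤ K` [folklore] -/
theorem rootCell_pedMV_mem_N (hN : I.NewOK) (hRm : ∀ t k, I.Rm t k ≤ I.R t) (hRmS : ∀ t k, I.Rm t (k + 1) ≤ I.R (t + 1))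
    (hRm2 : ∀ t, 2 ≤ I.Rm t 1) (hD : I.NewDisjoint) (hL : 0 < I.L) {K : ℕ} {c : Lab d} (hc : c ∈ I.histV.comp K) :
    (I.pedMV.toPGen id (K, c)).rootStep ≤ K ∧ (I.pedMV.toPGen id (K, c)).rootCell ∈ I.N (I.pedMV.toPGen id (K, c)).rootStep :=
  rootCell_toPGen_mem_newReg (wf_histV hN hRm hD hL) (levelClausesW_histV hN hRm hRmS hRm2 hD hL) K c hc

/-- **`inBox`** for the dissolved process, from the displayed box condition on the input. [folklore] -/
theorem inBox_pedMV (hN : I.NewOK) (hRm : ∀ t k, I.Rm t k ≤ I.R t) (hRmS : ∀ t k, I.Rm t (k + 1) ≤ I.R (t + 1))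
    (hRm2 : ∀ t, 2 ≤ I.Rm t 1) (hD : I.NewDisjoint) (hL : 0 < I.L) {n K : ℕ} (hbox : I.InBoxOK n K) {c : Lab d}
    (hc : c ∈ I.histV.comp K) (i : Fin d) :
    0 ≤ rootAnchor (I.pedMV.toPGen id (K, c)) i ∧
      I.L ^ levelOf I.s K (I.pedMV.toPGen id (K, c)).rootStep * (rootAnchor (I.pedMV.toPGen id (K, c)) i).toNat <
        n * I.L ^ K := by
  obtain ⟨hle, hmem⟩ := rootCell_pedMV_mem_N hN hRm hRmS hRm2 hD hL hc
  exact hbox _ hle _ hmem i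

/-! ## §5 The seven fields at one cutoff, packaged — no located open point among the hypotheses -/

/-- **THE JUNCTION AT A CUTOFF, PASS V**: the seven `RealisedDomainsW`-field shapes for the dissolved process's
pedigree at cutoff `K` (payload map `id`, live set `histV.comp K`, last-event domains `ZMV K`), under `NewOK`, the
memory domination and its one-step form, non-degenerate memory, disjoint new regions, `0 < L` and the box condition —
`NoFreshClusters` is no longer a hypothesis. [folklore] -/
theorem junction_pedMV (hN : I.NewOK) (hRm : ∀ t k, I.Rm t k ≤ I.R t) (hRmS : ∀ t k, I.Rm t (k + 1) ≤ I.R (t + 1))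
    (hRm2 : ∀ t, 2 ≤ I.Rm t 1) (hD : I.NewDisjoint) (hL : 0 < I.L) {n K : ℕ} (hbox : I.InBoxOK n K) :
    (∀ c c', Part.old c' true ∈ I.pedMV.parts c → I.pedMV.step c' + 1 = I.pedMV.step c) ∧
    (∀ c, I.pedMV.Forest c) ∧ (∀ c, I.pedMV.HeadOldest c) ∧
    (∀ c ∈ I.histV.comp K,
      RealisesW I.L I.s I.R (I.pedMV.toPGen id (K, c)) (I.ZMV K c) ∧
        PendingBefore I.L I.s I.R (I.pedMV.toPGen id (K, c)).lastStep (I.ZMV K c) K) ∧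
    (∀ c ∈ I.histV.comp K, anchorAt I.L I.s (I.pedMV.toPGen id (K, c)) (I.pedMV.toPGen id (K, c)).lastStep ∈ I.ZMV K c) ∧
    (∀ c ∈ I.histV.comp K, ∀ c' ∈ I.histV.comp K, c ≠ c' →
      Disjoint (curDomain I.L I.s (I.pedMV.toPGen id (K, c)) (I.ZMV K c) K)
        (curDomain I.L I.s (I.pedMV.toPGen id (K, c')) (I.ZMV K c') K)) ∧
    (∀ c ∈ I.histV.comp K, ∀ i, 0 ≤ rootAnchor (I.pedMV.toPGen id (K, c)) i ∧
      I.L ^ levelOf I.s K (I.pedMV.toPGen id (K, c)).rootStep * (rootAnchor (I.pedMV.toPGen id (K, c)) i).toNat <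
        n * I.L ^ K) :=
  ⟨renew_step_pedMV, forest_pedMV hN hRm hRmS hRm2 hD hL, headOldest_pedMV hN hRm hRmS hRm2 hD hL,
    fun _ hc => real_pedMV hN hRm hRmS hRm2 hD hL hc, fun _ hc => track_pedMV hN hRm hRmS hRm2 hD hL hc,
    fun _ hc _ hc' hne => disjoint_pedMV hN hRm hRmS hRm2 hD hL hc hc' hne,
    fun _ hc i => inBox_pedMV hN hRm hRmS hRm2 hD hL hbox hc i⟩

end RunInputM

/-! ## §6 The family form: `RealisedDomainsRW` with input-side conditions only -/

namespace InputFamily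

variable {ι : Type*} (Φ : InputFamily d ι)

/-- the family's pedigrees, pass V [folklore] -/
abbrev pedV (K : ℕ) (τ : ι) : Pedigree (ℕ × Lab d) (Lab d) := (Φ.run K τ).pedMV

/-- the family's live sets, pass V: the NAMES `(K, c)` of the dissolved components at the cutoff [folklore] -/
abbrev liveCV (K : ℕ) (τ : ι) : Finset (ℕ × Lab d) := ((Φ.run K τ).histV.comp K).image (Prod.mk K)

/-- the family's last-event domains, pass V, by name [folklore] -/
abbrev ZV (K : ℕ) (τ : ι) (a : ℕ × Lab d) : Finset (Pt d) := (Φ.run K τ).ZMV a.1 a.2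

/-- **THE JUNCTION, PACKAGED, PASS V.**  Under the displayed per-term INPUT conditions — `NewOK`, memory domination
`Rm ≤ R` and its one-step form `Rm t (k+1) ≤ R (t+1)`, non-degenerate memory `2 ≤ Rm t 1`, disjoint new regions,
`0 < L`, the box condition — the family's data form the END's memory-agnostic domain carrier `RealisedDomainsRW`;
no «no fresh clusters» condition. [folklore] -/
theorem realisedDomainsRW_of_familyV (T : ℕ → Finset ι) (n K₀ : ℕ)
    (hN : ∀ K, K₀ ≤ K → ∀ τ ∈ T K, (Φ.run K τ).NewOK)
    (hRm : ∀ K, K₀ ≤ K → ∀ τ ∈ T K, ∀ t k, (Φ.run K τ).Rm t k ≤ (Φ.run K τ).R t)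
    (hRmS : ∀ K, K₀ ≤ K → ∀ τ ∈ T K, ∀ t k, (Φ.run K τ).Rm t (k + 1) ≤ (Φ.run K τ).R (t + 1))
    (hRm2 : ∀ K, K₀ ≤ K → ∀ τ ∈ T K, ∀ t, 2 ≤ (Φ.run K τ).Rm t 1)
    (hD : ∀ K, K₀ ≤ K → ∀ τ ∈ T K, (Φ.run K τ).NewDisjoint) (hL : 0 < Φ.L)
    (hbox : ∀ K, K₀ ≤ K → ∀ τ ∈ T K, (Φ.run K τ).InBoxOK n K) :
    RealisedDomainsRW Φ.L Φ.s n K₀ Φ.R T Φ.pedV (fun _ _ => id) Φ.liveCV Φ.ZV where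
  renew_step K _ τ _ c c' h := RunInputM.renew_step_pedMV c c' h
  forest K hK τ hτ c :=
    RunInputM.forest_pedMV (hN K hK τ hτ) (hRm K hK τ hτ) (hRmS K hK τ hτ) (hRm2 K hK τ hτ) (hD K hK τ hτ) hL c
  headOldest K hK τ hτ c :=
    RunInputM.headOldest_pedMV (hN K hK τ hτ) (hRm K hK τ hτ) (hRmS K hK τ hτ) (hRm2 K hK τ hτ) (hD K hK τ hτ) hL c
  real K hK τ hτ a ha := by
    obtain ⟨c, hc, rfl⟩ := Finset.mem_image.1 ha
    exact RunInputM.real_pedMV (hN K hK τ hτ) (hRm K hK τ hτ) (hRmS K hK τ hτ) (hRm2 K hK τ hτ) (hD K hK τ hτ) hL hc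
  track K hK τ hτ a ha := by
    obtain ⟨c, hc, rfl⟩ := Finset.mem_image.1 ha
    exact RunInputM.track_pedMV (hN K hK τ hτ) (hRm K hK τ hτ) (hRmS K hK τ hτ) (hRm2 K hK τ hτ) (hD K hK τ hτ) hL hc
  disjoint K hK τ hτ a ha a' ha' hne := by
    obtain ⟨c, hc, rfl⟩ := Finset.mem_image.1 ha
    obtain ⟨c', hc', rfl⟩ := Finset.mem_image.1 ha'
    have hne' : c ≠ c' := fun h => hne (by rw [h])
    exact RunInputM.disjoint_pedMV (hN K hK τ hτ) (hRm K hK τ hτ) (hRmS K hK τ hτ) (hRm2 K hK τ hτ) (hD K hK τ hτ)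
      hL hc hc' hne'
  inBox K hK τ hτ a ha i := by
    obtain ⟨c, hc, rfl⟩ := Finset.mem_image.1 ha
    exact RunInputM.inBox_pedMV (hN K hK τ hτ) (hRm K hK τ hτ) (hRmS K hK τ hτ) (hRm2 K hK τ hτ) (hD K hK τ hτ) hL
      (hbox K hK τ hτ) hc i

end InputFamily

/-! ## §7 The volume identity (the cost-side half of the pass-V bridge, for M5's volume-exponential cost factor) -/

namespace RunInputM

variable {I : RunInputM d}

/-- the union of a list of pairwise disjoint domains has the sum of their volumes [folklore] -/
theorem card_unionL_of_pairwise_disjoint :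
    ∀ l : List (Finset (Pt d)), l.Pairwise (fun A B => Disjoint A B) → (unionL l).card = (l.map Finset.card).sum
  | [], _ => by simp
  | A :: l, h => by
      rw [List.pairwise_cons] at h
      rw [unionL_cons, List.map_cons, List.sum_cons, ← card_unionL_of_pairwise_disjoint l h.2,
        Finset.card_union_of_disjoint]
      exact Finset.disjoint_left.2 fun x hxA hxU => by
        obtain ⟨B, hB, hxB⟩ := mem_unionL.1 hxU
        exact Finset.disjoint_left.1 (h.1 B hB) hxA hxB

/-- **A FRESH CLUSTER'S VOLUME IS THE SUM OF ITS REGIONS' VOLUMES** (under `NewOK`, `Rm ≤ R` and disjoint new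
regions): its domain is the union of its regions (cover + (G-join)), pairwise disjoint. [folklore] -/
theorem card_snd_fresh_eq_sum (hN : I.NewOK) (hRm : ∀ t k, I.Rm t k ≤ I.R t) (hD : I.NewDisjoint) {j : ℕ} {c : Lab d}
    (hf : I.histM.Fresh j c) : (c.2).card = ((I.histM.news j c).map fun n => (n.2).card).sum := by
  have hdom := ComponentHistory.dom_eq_unionL_news_of_fresh (I.coverOK_histM hN) (I.levelClausesW_histM hN hRm).dom_join hf
  rw [show c.2 = RunInput.domL j c from rfl, hdom, card_unionL_of_pairwise_disjoint _ ?_, List.map_map]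
  · rfl
  · have hsub : ∀ n ∈ I.histM.news j c, n ∈ I.N j := fun n hn => (I.wf_histM hN).news_sub j c hf.mem n hn
    have hnd : (I.histM.news j c).Nodup := (I.wf_histM hN).news_nodup j c
    rw [List.pairwise_map]
    exact hnd.imp_of_mem fun {n n'} hn hn' hne => hD j n (hsub n hn) n' (hsub n' hn') hne

/-- **THE PER-LEVEL VOLUME-EXPONENTIAL COST IS UNCHANGED BY THE DISSOLUTION**: for any factor `Λ`,
`∏_{x ∈ histV.comp j} Λ ^ #x.2 = ∏_{c ∈ histM.comp j} Λ ^ #c.2` — M2 brick B's cost product (owner's SHAPE ANSWER,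
R4: `Λ K j ^ #(c.2)`) composes with the pass-V junction token for token. [folklore] -/
theorem prod_pow_card_comp_histV {M : Type*} [CommMonoid M] (hN : I.NewOK) (hRm : ∀ t k, I.Rm t k ≤ I.R t)
    (hD : I.NewDisjoint) (Λ : M) (j : ℕ) :
    ∏ x ∈ I.histV.comp j, Λ ^ (x.2).card = ∏ c ∈ I.histM.comp j, Λ ^ (c.2).card := by
  refine ComponentHistory.prod_comp_dissolve_of_mul (I.wf_histM hN) (labelOK_histM hN hD) j (fun c => Λ ^ (c.2).card)
    fun c _ hf => ?_
  rw [card_snd_fresh_eq_sum hN hRm hD hf]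
  induction I.histM.news j c with
  | nil => simp
  | cons n l ih => rw [List.map_cons, List.prod_cons, List.map_cons, List.sum_cons, pow_add, ih]

/-- **THE EVENT PRODUCT OF A `pedMV`-GENEALOGY IS THAT OF THE DISSOLVED EXTRACTION** (leaf-04's IR-41-8 part 1
`evProd_toPGen_id_eq_pgenR` on `histV`, whose chosen order is admissible); with part 4a's `evProd_pgenR_dissolve` ∕
`prod_comp_dissolve_evProd` this ties M2 brick B's weights to the pass-V pedigrees. [folklore] -/
theorem evProd_pedMV_eq_pgenR {M : Type*} [CommMonoid M] (hN : I.NewOK) (hRm : ∀ t k, I.Rm t k ≤ I.R t)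
    (hRmS : ∀ t k, I.Rm t (k + 1) ≤ I.R (t + 1)) (hRm2 : ∀ t, 2 ≤ I.Rm t 1) (hD : I.NewDisjoint) (hL : 0 < I.L)
    (fB : ℕ → ℕ → Lab d → M) (fR : ℕ → M) {j : ℕ} {c : Lab d} (hc : c ∈ I.histV.comp j) :
    evProd fB fR (I.pedMV.toPGen id (j, c)) = evProd fB fR (I.histV.pgenR I.rnwM j c) :=
  evProd_toPGen_id_eq_pgenR fB fR (wf_histV hN hRm hD hL)
    (orderOK_ordOf (wf_histV hN hRm hD hL) (levelClausesW_histV hN hRm hRmS hRm2 hD hL)) hc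

end RunInputM

/-! ## §8 Sanity: print's current-memory reading meets the two memory side conditions -/

/-- **PRINT'S READING MEETS THE ONE-STEP DOMINATION**: for the current-memory instance `ofCurrent J`
(`Rm t k = R (t + k)`) with NON-INCREASING sizes `R`, `Rm t (k+1) = R (t+k+1) ≤ R (t+1)`. [folklore] -/
theorem rmS_ofCurrent (J : RunInput d) (hR : ∀ a b, a ≤ b → J.R b ≤ J.R a) :
    ∀ t k, (RunInputM.ofCurrent J).Rm t (k + 1) ≤ (RunInputM.ofCurrent J).R (t + 1) :=
  fun t k => hR (t + 1) (t + (k + 1)) (by omega)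

/-- … and the non-degeneracy `2 ≤ Rm t 1` whenever every size is at least `2` (`R_j = L^s ≥ L ≥ 2` in the printed
window; displayed). [folklore] -/
theorem rm2_ofCurrent (J : RunInput d) (h2 : ∀ t, 2 ≤ J.R t) : ∀ t, 2 ≤ (RunInputM.ofCurrent J).Rm t 1 :=
  fun t => h2 (t + 1)

/-- the frozen model meets the one-step domination only where the sizes do not DROP (`R t ≤ R (t+1)`): pass V is for
print's current-memory reading (located finding #3), not for the superseded frozen convention. [folklore] -/
theorem rmS_ofFrozen_iff (J : RunInput d) :
    (∀ t k, (RunInputM.ofFrozen J).Rm t (k + 1) ≤ (RunInputM.ofFrozen J).R (t + 1)) ↔ ∀ t, J.R t ≤ J.R (t + 1) :=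
  ⟨fun h t => h t 0, fun h t _ => h t⟩

end

end Summit.QuantumFields.BalabanUV.T4Continuum.HistoryGenealogyInstantiate
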